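import Summits.ABC.ABC.Theses.IsogenyGlueCongruence

/-!
# `U_ss` — the proposed restatement of stmt-ABC-13919, elaborated STANDALONE in the Theses context

Only the route file is imported (exactly the context in which the gate elaborates item signatures).
`U_ss` = `EllipticGluingPrimeBound` with the three binders of `ModularJacobianMultipliers` added
(`[W.IsGloballyMinimal] [NeZero (W.conductorNorm ℤ)], W.IsSemistable ℤ →`).  Lead c7, 2026-08-17.
-/

-- `Summit.ABC.ABC` is the mandated summit-side namespace (single-conjunct summit).
set_option linter.dupNamespace false

namespace Summit.ABC.ABC.Cruxes.EllipticGluingPrimeBound.Restate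

/-- The restated crux `U_ss` (signature proposal D3' of RESTATE-semistable.md), as a term of
type `Prop` built from the route file's vocabulary alone. -/
def SemistableEllipticGluingPrimeBound : Prop :=
  ∃ κ C : ℝ, 0 ≤ κ ∧ ∀ (W : WeierstrassCurve ℚ) [W.IsElliptic] [W.IsGloballyMinimal] [NeZero (W.conductorNorm ℤ)], W.IsSemistable ℤ → ∀ (E B : Literature.AlgebraicGeometry.Motives.AbelianVariety.{0} ℚ) (e : E.geomPoints ≃+ W.geomPoints), (∀ (σ : Field.absoluteGaloisGroup ℚ) (P : E.geomPoints), e (σ • P) = σ • e P) → ∀ ℓ : ℕ, ℓ.Prime → (∃ (α : E ⟶ B) (β : B ⟶ E) (n : ℤ), n ≠ 0 ∧ CategoryTheory.CategoryStruct.comp α β = n • CategoryTheory.CategoryStruct.id E) → (∀ (α : E ⟶ B) (β : B ⟶ E) (n : ℤ), CategoryTheory.CategoryStruct.comp α β = n • CategoryTheory.CategoryStruct.id E → (ℓ : ℤ) ∣ n) → (ℓ : ℝ) ≤ C * ((B.dim : ℝ) * max 1 W.stableFaltingsHeight) ^ κ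

/-- `U ⟹ U_ss` in this standalone context (restriction). -/
theorem semistable_of_crux
    (hU : Summit.ABC.ABC.Theses.IsogenyGlueCongruence.EllipticGluingPrimeBound) :
    SemistableEllipticGluingPrimeBound := by
  obtain ⟨κ, C, hκ, h⟩ := hU
  exact ⟨κ, C, hκ, fun W _ _ _ _ E B e he ℓ hℓ hex hall ↦ h W E B e he ℓ hℓ hex hall⟩

/-- The glue item restated on `U_ss` elaborates in the same context:
`U_ss → ModularJacobianMultipliers → SemistableHeightPolyBound → DegreePrimesPolyBounded`
(its proof is the landed `Summit.ABC.ABC.Theorems.GluingSlices.stub_semistableGlue`, p141036). -/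
def SemistableDegreePrimesOfGluingBound : Prop :=
  SemistableEllipticGluingPrimeBound →
    Summit.ABC.ABC.Theses.IsogenyGlueCongruence.ModularJacobianMultipliers →
    Summit.ABC.ABC.Theses.IsogenyGlueCongruence.SemistableHeightPolyBound →
    Summit.ABC.ABC.Theses.IsogenyGlueCongruence.DegreePrimesPolyBounded

end Summit.ABC.ABC.Cruxes.EllipticGluingPrimeBound.Restate
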